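import Summits.RiemannHypothesis.RiemannHypothesis.Theorems.GroundBartaGroundBartaFloorInnerPrelim
import HarnessLib

/-!
# Crux `GroundBarta.GroundBartaFloor` (stmt-RiemannHypothesis-18389) — line `inner-cutoff-strong-EL`
# (part 2/3: the per-collar inequality)

Barta's floor for the FULL windowed Weil form, by the STRONG Euler–Lagrange identity of a ground
state against the INNER smooth cut-offs of Riemann's kernel.

Let the window `a > 0` carry a ground state `u` (operator-free: `IsWeilGroundState a u`) that is real
and `≥ 0` a.e. on `(-a, a)`; let `v ≥ 0` be its real representative (`u = v` a.e.).  For a collar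
width `0 < η < a` let `θ_η` be a smooth even plateau cut-off, `θ_η = 1` on `[-(a-η), a-η]`,
`θ_η = 0` off `(-a, a)`, `0 ≤ θ_η ≤ 1`, `|θ_η'| ≤ D/η` (`stub_groundCutoff`).  Then

* the INNER PROBE `h_η = Φ θ_η` is a Weil test supported in the window, so the strong Euler–Lagrange
  identity (`IsWeilGroundState.weilFunctional_eq_energy_mul`, in tree, RH-free) gives
  `W(v ⋆ h̃_η) = ε(a) ∫ v Φ θ_η`;
* HARMONIC SPLIT (`stub_groundHarmonicSplit`): `Φ̂ = ξ` vanishes on the zeros, so by the class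
  explicit formula `W(v ⋆ h̃_η) = -W(v ⋆ κ̃_η)`, `κ_η = Φ(1 - θ_η) ≥ 0` the collar-plus-tail kernel;
* TERMWISE SIGNS for `f_η = v ⋆ κ̃_η ≥ 0` (smooth, exponential class: `stub_groundPairingClass`):
  prime term `≥ 0`; polar term `= (∫ κ_η cosh(t/2)) · (∫ v · 2cosh(t/2)) ≤ ϖ_{a-η} · C(v)`
  (`stub_groundPolar`); archimedean term (Bombieri's form) `≤ K₀ (m (m S)^{1/2})^{1/2}` with
  `m = f_η(0) ≤ Φ(0) √(2η)` (Cauchy–Schwarz on the collar, `‖v‖₂ ≤ 1`) and `S = sup |f_η'| ≤ B/η`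
  (`stub_groundArchBound`);
* `η → 0⁺`: `ε(a) ∫ vΦ ≥ -ϖ_a C(v)`, and `Φ(a) C(v) ≤ 2cosh(a/2) ∫ vΦ`, `∫ vΦ > 0` give
  `ε(a) ≥ -e(a)`, `e(a) = 2ϖ_a cosh(a/2)/Φ(a) = groundBartaRate a → 0` (`stub_groundRateDecay`,
  LANDED in `GroundBartaGroundBartaFloorRateDecay`).

No outer cut-off, no window-continuity of `ε`, no minimising sequence is used.  The five stubs of
the line (`stub_groundCutoff`, `stub_groundPairingClass`, `stub_groundHarmonicSplit`,
`stub_groundPolar`, `stub_groundArchBound`) and the rate `stub_groundRateDecay` are LANDED in the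
sibling `GroundBartaGroundBartaFloorInner*.lean` / `…RateDecay.lean` files; this file is the
sorry-free composition `GroundBartaFloor_of_innerCutoff`, a SECOND, independent proof of the crux (the first is
prover A's outer-cutoff line, `Theorems/GroundBartaGroundBartaFloor*.lean` of 2026-08-18).
Prover B, speedrun unit `sr-gb-rung-b`.
-/

set_option linter.dupNamespace false

noncomputable section

open Set MeasureTheory Filter Complex
open scoped Real Topology ComplexConjugate

namespace Summit.RiemannHypothesis.RiemannHypothesis.Theorems.GroundBartaFloor

open Literature.NumberTheory.LFunctions
open Summit.RiemannHypothesis.RiemannHypothesis.Theorems.GroundStatesConvergeToXi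

/-! The five stubs of the line are LANDED (prover B, `--as helper` on the item):
`stub_groundCutoff` (…InnerCutoff), `stub_groundPairingClass`, `stub_groundPolar` (…InnerPairing),
`stub_groundHarmonicSplit` (…InnerSplit), `stub_groundArchBound` (…InnerArchBound); the rate
`stub_groundRateDecay` is prover −2's (…RateDecay). -/

/-! ## The per-collar inequality -/

/-- **The per-collar inequality.**  For a window `a` carrying the non-negative ground state `v`
and a collar of width `η ∈ (0, 1]`, `η < a`, with inner cut-off `θ`:
`ε(a) ∫ vΦθ ≥ -(ϖ_{a-η} ∫ v·2cosh(t/2) + K₀ (α (αβ)^{1/2} η^{1/4})^{1/2})`,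
`α = 2Φ(0)`, `β = (M + Φ(0) D) ∫ v`. -/
theorem ic_perCollar {a η D K₀ M : ℝ} {v θ : ℝ → ℝ} (hη : 0 < η)
    (hη1 : η ≤ 1) (hv : Measurable v) (hv0 : ∀ t, 0 ≤ v t) (hvs : ∀ t, t ∉ Ioo (-a) a → v t = 0)
    (hvi : Integrable v) (hv2 : Integrable fun t => v t ^ 2) (hv21 : ∫ t, v t ^ 2 ≤ 1)
    (hvG : IsWeilGroundState a fun t => ((v t : ℝ) : ℂ))
    (hθ : ContDiff ℝ (⊤ : ℕ∞) θ) (hθ1 : ∀ t, |t| ≤ a - η → θ t = 1) (hθ0 : ∀ t, a ≤ |t| → θ t = 0)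
    (hθ01 : ∀ t, 0 ≤ θ t ∧ θ t ≤ 1) (hθe : ∀ t, θ (-t) = θ t) (hD : 0 ≤ D)
    (hθd : ∀ t, |deriv θ t| ≤ D / η) (hK₀ : 0 ≤ K₀)
    (hK : ∀ (g : ℝ → ℝ) (S : ℝ), ContDiff ℝ 1 g → (∀ t, 0 ≤ g t) →
      (∃ K : ℝ, ∀ t, |g t| ≤ K) → (∀ t, |deriv g t| ≤ S) →
      (weilArchTermBombieri fun t => ((g t : ℝ) : ℂ)).re ≤ K₀ * Real.sqrt (g 0 * Real.sqrt (g 0 * S)))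
    (hM : 0 ≤ M) (hM' : ∀ t, |deriv weilThetaPhi t| ≤ M) :
    -(groundThetaPolarWeight (a - η) * (∫ t, v t * (2 * Real.cosh (t / 2))) +
        K₀ * Real.sqrt (2 * weilThetaPhi 0 * Real.sqrt (2 * weilThetaPhi 0 * ((M + weilThetaPhi 0 * D) * ∫ t, v t)) *
          Real.sqrt (Real.sqrt η))) ≤
      weilGroundEnergy a * ∫ t, v t * (weilThetaPhi t * θ t) := by
  -- names
  set vc : ℝ → ℂ := fun t => ((v t : ℝ) : ℂ) with hvc
  set hc : ℝ → ℂ := fun t => ((weilThetaPhi t * θ t : ℝ) : ℂ) with hhc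
  set κc : ℝ → ℂ := fun t => ((weilThetaPhi t * (1 - θ t) : ℝ) : ℂ) with hκc
  set F : ℝ → ℂ := weilConv vc (weilReflect κc) with hFdef
  set f : ℝ → ℝ := fun t => ∫ s, v s * (weilThetaPhi (s - t) * (1 - θ (s - t))) with hfdef
  set cv : ℝ := ∫ t, v t * (2 * Real.cosh (t / 2)) with hcv
  set cκ : ℝ := ∫ t, weilThetaPhi t * (1 - θ t) * Real.cosh (t / 2) with hcκ
  set α : ℝ := 2 * weilThetaPhi 0 with hα
  set β : ℝ := (M + weilThetaPhi 0 * D) * ∫ t, v t with hβ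
  set S : ℝ := β / η with hS
  have hΦ0 := weilThetaPhi_pos 0
  have hIv : 0 ≤ ∫ t, v t := integral_nonneg hv0
  have hcv0 : 0 ≤ cv := integral_nonneg fun t => mul_nonneg (hv0 t)
    (mul_nonneg zero_le_two (Real.cosh_pos _).le)
  have hα0 : 0 ≤ α := by positivity
  have hβ0 : 0 ≤ β := by positivity
  have hS0 : 0 ≤ S := by positivity
  -- (1) the probe is a window test; strong Euler–Lagrange
  have hprobe : IsWeilTest hc := ic_isWeilTest_probe hθ hθ0
  have hsupp : tsupport hc ⊆ Icc (-a) a := ic_tsupport_probe_subset hθ0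
  have hEL := hvG.weilFunctional_eq_energy_mul hprobe hsupp
  have hpair : ∫ t, vc t * conj (hc t) = ((∫ t, v t * (weilThetaPhi t * θ t) : ℝ) : ℂ) := by
    rw [← integral_complex_ofReal]
    refine integral_congr_ae (ae_of_all _ fun t => ?_)
    simp only [hvc, hhc, Complex.conj_ofReal]
    push_cast
    ring
  rw [hpair] at hEL
  have hELre : (weilFunctional (weilConv vc (weilReflect hc))).re =
      weilGroundEnergy a * ∫ t, v t * (weilThetaPhi t * θ t) := by
    rw [hEL]; simp
  -- (2) harmonic split
  have hsplit : weilFunctional (weilConv vc (weilReflect hc)) = -weilFunctional F :=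
    stub_groundHarmonicSplit (a := a) hv hv0 hvs hvi hθ hθ0 hθ01
  -- (3) the collar pairing: class, formula, derivative
  obtain ⟨hFcd, ⟨C, hC0, hC1, hC2⟩, hFform, hFderiv⟩ :=
    stub_groundPairingClass (a := a) hv hv0 hvs hvi hθ hθ0 hθ01
  have hFf : ∀ t, F t = ((f t : ℝ) : ℂ) := fun t => hFform t
  have hFf' : F = fun t => ((f t : ℝ) : ℂ) := funext hFf
  have hf0 : ∀ t, 0 ≤ f t := fun t => integral_nonneg fun s => mul_nonneg (hv0 s)
    (mul_nonneg (weilThetaPhi_pos _).le (by linarith [(hθ01 (s - t)).2]))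
  -- (4) `W(F) = polar - prime + arch_Bombieri`
  have harch : weilArchTerm F = weilArchTermBombieri F :=
    (weilArchTermBombieri_eq_weilArchTerm_expClass (C := C) (b₀ := 1) hFcd (by norm_num) hC0 hC1 hC2).symm
  have hWre : (weilFunctional F).re =
      (weilPolarTerm F).re - (weilPrimeTerm F).re + (weilArchTermBombieri F).re := by
    rw [weilFunctional, harch]; simp
  -- (5) polar term
  have hpolar : (weilPolarTerm F).re = cκ * cv := by
    rw [hFdef, stub_groundPolar (a := a) hv hv0 hvs hvi hθ hθ0 hθ01 hθe, Complex.ofReal_re]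
  have hcκ : cκ ≤ groundThetaPolarWeight (a - η) :=
    ic_collar_cosh_le (fun t ht => hθ1 t ht) hθ01
  -- (6) prime term
  have hprime : 0 ≤ (weilPrimeTerm F).re := by
    have e : weilPrimeTerm F = ((∑' n : ℕ, (ArithmeticFunction.vonMangoldt n : ℝ) / Real.sqrt n *
        (f (Real.log n) + f (-Real.log n)) : ℝ) : ℂ) := by
      rw [weilPrimeTerm, Complex.ofReal_tsum]
      refine tsum_congr fun n => ?_
      rw [hFf, hFf]
      push_cast
      ring
    rw [e, Complex.ofReal_re]
    exact tsum_nonneg fun n => mul_nonneg (div_nonneg ArithmeticFunction.vonMangoldt_nonneg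
      (Real.sqrt_nonneg _)) (add_nonneg (hf0 _) (hf0 _))
  -- (7) archimedean term
  have hB₁ : ∀ t, |deriv (fun t => weilThetaPhi t * (1 - θ t)) t| ≤ (M + weilThetaPhi 0 * D) / η := by
    intro t
    have hθd' : HasDerivAt θ (deriv θ t) t :=
      (hθ.differentiable (by simp) t).hasDerivAt
    have hd : HasDerivAt (fun t => weilThetaPhi t * (1 - θ t))
        (deriv weilThetaPhi t * (1 - θ t) + weilThetaPhi t * (0 - deriv θ t)) t := by
      have h1 : HasDerivAt weilThetaPhi (deriv weilThetaPhi t) t :=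
        (differentiable_weilThetaPhi t).hasDerivAt
      exact h1.mul ((hasDerivAt_const t (1 : ℝ)).sub hθd')
    rw [hd.deriv]
    have h1 : |deriv weilThetaPhi t * (1 - θ t)| ≤ M := by
      rw [abs_mul]
      calc |deriv weilThetaPhi t| * |1 - θ t| ≤ M * 1 := by
            refine mul_le_mul (hM' t) ?_ (abs_nonneg _) hM
            rw [abs_le]; constructor <;> linarith [(hθ01 t).1, (hθ01 t).2]
        _ = M := mul_one M
    have h2 : |weilThetaPhi t * (0 - deriv θ t)| ≤ weilThetaPhi 0 * (D / η) := by
      rw [abs_mul, zero_sub, abs_neg, abs_of_pos (weilThetaPhi_pos t)]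
      exact mul_le_mul (gbf_weilThetaPhi_le_zero_val t) (hθd t) (abs_nonneg _) hΦ0.le
    have h3 : M ≤ M / η := by
      rw [le_div_iff₀ hη]; nlinarith
    calc |deriv weilThetaPhi t * (1 - θ t) + weilThetaPhi t * (0 - deriv θ t)|
        ≤ |deriv weilThetaPhi t * (1 - θ t)| + |weilThetaPhi t * (0 - deriv θ t)| := abs_add_le _ _
      _ ≤ M / η + weilThetaPhi 0 * (D / η) := add_le_add (h1.trans h3) h2
      _ = (M + weilThetaPhi 0 * D) / η := by ring
  have hfS : ∀ t, |deriv f t| ≤ S := by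
    intro t
    have hFd : HasDerivAt F (deriv F t) t := (hFcd.differentiable (by simp) t).hasDerivAt
    have hfd : HasDerivAt f ((deriv F t).re) t := by
      have h := (Complex.reCLM.hasFDerivAt.comp_hasDerivAt t hFd)
      have e : (⇑Complex.reCLM ∘ F) = f := by
        funext x; simp [hFf x]
      rw [e] at h
      simpa using h
    rw [hfd.deriv]
    calc |(deriv F t).re| ≤ ‖deriv F t‖ := Complex.abs_re_le_norm _
      _ ≤ (M + weilThetaPhi 0 * D) / η * ∫ s, v s := hFderiv _ hB₁ t
      _ = S := by simp only [hS, hβ]; ring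
  have hfcd : ContDiff ℝ 1 f := by
    have h : ContDiff ℝ (⊤ : ℕ∞) (fun t => (F t).re) := Complex.reCLM.contDiff.comp hFcd
    have e : (fun t => (F t).re) = f := by funext x; simp [hFf x]
    rw [e] at h
    exact h.of_le (by exact_mod_cast le_top)
  have hfbd : ∃ K : ℝ, ∀ t, |f t| ≤ K := by
    refine ⟨max C 0, fun t => ?_⟩
    have h := hC0 t
    change ‖F t‖ ≤ _ at h
    rw [hFf, Complex.norm_real, Real.norm_eq_abs] at h
    refine h.trans ?_
    calc C * Real.exp (-(1 * |t|)) ≤ max C 0 * Real.exp (-(1 * |t|)) :=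
          mul_le_mul_of_nonneg_right (le_max_left _ _) (Real.exp_pos _).le
      _ ≤ max C 0 * 1 := mul_le_mul_of_nonneg_left
          (Real.exp_le_one_iff.2 (by nlinarith [abs_nonneg t])) (le_max_right _ _)
      _ = max C 0 := mul_one _
  have harchB : (weilArchTermBombieri F).re ≤ K₀ * Real.sqrt (f 0 * Real.sqrt (f 0 * S)) := by
    rw [hFf']
    exact hK f S hfcd hf0 hfbd hfS
  -- (8) the collar mass `m = f 0 ≤ α √η` and the error term
  have hm : f 0 ≤ α * Real.sqrt η := by
    have e : f 0 = ∫ s, v s * (weilThetaPhi s * (1 - θ s)) := by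
      simp only [hfdef, sub_zero]
    rw [e, hα]
    exact ic_collar_mass_le hη hv0 hvs hv2 hv21 hθ1 hθ01
  have hm0 : 0 ≤ f 0 := hf0 0
  have herr : Real.sqrt (f 0 * Real.sqrt (f 0 * S)) ≤
      Real.sqrt (α * Real.sqrt (α * β) * Real.sqrt (Real.sqrt η)) := by
    apply Real.sqrt_le_sqrt
    -- compare squares: (m √(mS))² = m³ S ≤ α³ β √η = (α √(αβ) η^{1/4})²
    have hX0 : 0 ≤ f 0 * Real.sqrt (f 0 * S) := mul_nonneg hm0 (Real.sqrt_nonneg _)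
    have hY0 : 0 ≤ α * Real.sqrt (α * β) * Real.sqrt (Real.sqrt η) := by positivity
    have hsη : 0 ≤ Real.sqrt η := Real.sqrt_nonneg η
    have hXsq : (f 0 * Real.sqrt (f 0 * S)) ^ 2 = f 0 ^ 3 * S := by
      rw [mul_pow, Real.sq_sqrt (mul_nonneg hm0 hS0)]; ring
    have hYsq : (α * Real.sqrt (α * β) * Real.sqrt (Real.sqrt η)) ^ 2 = α ^ 3 * β * Real.sqrt η := by
      rw [mul_pow, mul_pow, Real.sq_sqrt (mul_nonneg hα0 hβ0), Real.sq_sqrt hsη]; ring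
    have hm3 : f 0 ^ 3 ≤ (α * Real.sqrt η) ^ 3 :=
      pow_le_pow_left₀ hm0 hm 3
    have key : f 0 ^ 3 * S ≤ α ^ 3 * β * Real.sqrt η := by
      calc f 0 ^ 3 * S ≤ (α * Real.sqrt η) ^ 3 * S := mul_le_mul_of_nonneg_right hm3 hS0
        _ = α ^ 3 * β * Real.sqrt η := by
            have hsq : Real.sqrt η ^ 2 = η := Real.sq_sqrt hη.le
            have e1 : (α * Real.sqrt η) ^ 3 * S = α ^ 3 * (Real.sqrt η ^ 2) * Real.sqrt η * S := by ring
            rw [e1, hsq, hS]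
            field_simp
    refine (pow_le_pow_iff_left₀ hX0 hY0 (by norm_num : (2 : ℕ) ≠ 0)).1 ?_
    rw [hXsq, hYsq]
    exact key
  -- (9) assemble
  have hmain : (weilFunctional F).re ≤ groundThetaPolarWeight (a - η) * cv +
      K₀ * Real.sqrt (α * Real.sqrt (α * β) * Real.sqrt (Real.sqrt η)) := by
    rw [hWre, hpolar]
    have h1 : cκ * cv ≤ groundThetaPolarWeight (a - η) * cv := mul_le_mul_of_nonneg_right hcκ hcv0
    have h2 : (weilArchTermBombieri F).re ≤
        K₀ * Real.sqrt (α * Real.sqrt (α * β) * Real.sqrt (Real.sqrt η)) :=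
      harchB.trans (mul_le_mul_of_nonneg_left herr hK₀)
    linarith
  rw [← hELre, hsplit, Complex.neg_re]
  linarith

end Summit.RiemannHypothesis.RiemannHypothesis.Theorems.GroundBartaFloor

end
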